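import Mathlib
import Summits.FinalStateConjecture.FinalStateConjecture.Theorems.LaminatedThresholdCombInterpolation
import Summits.FinalStateConjecture.FinalStateConjecture.Theorems.LaminatedThresholdCombSheets

/-!
# Comb lemma, layer 3: the abstract comb (cone-field λ-lemma with two-sided seeds)

For a continuous map `T` of `E × ℝ` satisfying the tube hypotheses (H1)–(H3) of
`CombConeDynamics` and two Lipschitz seed graphs, `t = g₊ x` above the tube and `t = g₋ x` below
it, there are a functional `Φ`, continuous on the ball of radius `ρ`, with `Φ 0 = 0`, and the
code set `K = {0} ∪ {±2^{-(m+1)}}` (accumulating at `0` from both sides) such that every point of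
the ball whose code lies in `K` has an orbit that either stays in the ball forever (code `0`: the
point lies between the two limit sheets), or lands ON the upper seed graph (positive codes: the
point lies on an upper preimage sheet), or lands ON the lower seed graph (negative codes), with
the orbit segment up to the landing time confined to an explicit box. This is the corrected
Stub 1 of line `heteroclinic_comb` (crux `LaminatedThreshold`) in abstract (cone-field) form.
-/

set_option linter.dupNamespace false

namespace Summit.FinalStateConjecture.FinalStateConjecture.Theorems.LaminatedThreshold.Comb

open Set Function Filter Topology

variable {E : Type*} [NormedAddCommGroup E]

/-- **The abstract comb lemma.** [folklore] -/
theorem comb_abstract : ∀ {E : Type*} [NormedAddCommGroup E] {T : E × ℝ → E × ℝ} {gp gm : E → ℝ} {ρ lam μ κ δ ap bp am bm kg : ℝ}, Continuous T → 0 < ρ → 0 ≤ lam → lam ≤ 1 → 0 ≤ κ → 0 ≤ δ → 1 < μ - δ → (∀ p : E × ℝ, ‖p.1‖ ≤ ρ → ‖(T p).1‖ ≤ lam * ‖p.1‖) → (∀ p q : E × ℝ, ‖p.1‖ ≤ ρ → ‖q.1‖ ≤ ρ → p.2 ≤ q.2 → ‖q.1 - p.1‖ ≤ κ * (q.2 -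 p.2) → μ * (q.2 - p.2) ≤ (T q).2 - (T p).2 ∧ ‖(T q).1 - (T p).1‖ ≤ κ * ((T q).2 - (T p).2)) → (∀ x : E, ‖x‖ ≤ ρ → |(T (x, 0)).2| ≤ δ * ‖x‖) → (∀ x : E, ‖x‖ ≤ ρ → ap ≤ gp x) → (∀ x : E, ‖x‖ ≤ ρ → gp x ≤ bp) → ρ < ap → bp < (μ - δ) * ap → (∀ x x' : E, ‖x‖ ≤ ρ → ‖x'‖ ≤ ρ → |gp x - gp x'| ≤ kg * ‖x - x'‖) → (∀ x : E, ‖x‖ ≤ ρ → gm x ≤ am) → (∀ x : E, ‖x‖ ≤ ρ → bm ≤ gm x) → am < -ρ → (μ - δ) * am < bm → (∀ x x' : E, ‖x‖ ≤ ρ → ‖x'‖ ≤ ρ → |gm x - gm x'| ≤ kg * ‖x - x'‖) → 0 ≤ kg → kg * κ < 1 → ∃ (Φ : E × ℝ → ℝ) (K : Set ℝ), Φ 0 = 0 ∧ (0 : ℝ) ∈ K ∧ (∀ η : ℝ, 0 < η → (K ∩ Set.Ioo (0 - η) 0).Nonempty ∧ (K ∩ Set.Ioo 0 (0 + η)).Nonempty)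 ∧ ContinuousOn Φ (Metric.ball 0 ρ) ∧ ∀ p ∈ Metric.ball (0 : E × ℝ) ρ, Φ p ∈ K → (∀ n, T^[n] p ∈ Metric.ball (0 : E × ℝ) ρ) ∨ (∃ n, (T^[n] p).2 = gp (T^[n] p).1 ∧ ∀ j ≤ n, ‖(T^[j] p).1‖ ≤ ‖p.1‖ ∧ -‖p.1‖ ≤ (T^[j] p).2 ∧ (T^[j] p).2 ≤ bp) ∨ (∃ n, (T^[n] p).2 = gm (T^[n] p).1 ∧ ∀ j ≤ n, ‖(T^[j] p).1‖ ≤ ‖p.1‖ ∧ bm ≤ (T^[j] p).2 ∧ (T^[j] p).2 ≤ ‖p.1‖) := by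
  intro E _ T gp gm ρ lam μ κ δ ap bp am bm kg hT hρ hlam0 hlam1 hκ hδ hμδ hx hcone haxis hgpa hgpb hρap habp hgplip hgma hgmb hρam habm hgmlip hkg0 hkg
  have hlamμ : lam < μ - δ := by linarith
  -- the upper sheet family of `T` for the seed `gp`
  obtain ⟨N, H, Hinf, hHc, hdec, hunif, -, hhit, hb, hnb, hbelow, habove⟩ :=
    exists_upper_sheets hT hρ hlam0 hlam1 hκ hδ hμδ hx hcone haxis hgpa hgpb hρap habp hgplip hkg0
      hkg
  -- the upper sheet family of the mirror map for the seed `-gm`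
  set T' : E × ℝ → E × ℝ := fun q ↦ ((T (q.1, -q.2)).1, -(T (q.1, -q.2)).2) with hT'
  obtain ⟨N', H', Hinf', hHc', hdec', hunif', -, hhit', hb', hnb', hbelow', habove'⟩ :=
    exists_upper_sheets (T := T') (g := fun x ↦ -gm x) (a := -am) (b := -bm) (continuous_mirror hT)
      hρ hlam0 hlam1 hκ hδ hμδ (mirror_hx hx) (mirror_hcone hcone) (mirror_haxis haxis)
      (fun x hx' ↦ by linarith [hgma x hx']) (fun x hx' ↦ by linarith [hgmb x hx'])
      (by linarith) (by linarith)
      (fun x x' hx₁ hx₂ ↦ by rw [← abs_neg]; convert hgmlip x x' hx₁ hx₂ using 2; ring) hkg0 hkg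
  have hmir : ∀ n (x : E) (s : ℝ), T'^[n] (x, s) = ((T^[n] (x, -s)).1, -(T^[n] (x, -s)).2) :=
    fun n x s ↦ iterate_mirror T n (x, s)
  have hmir1 : ∀ n (x : E) (s : ℝ), (T'^[n] (x, s)).1 = (T^[n] (x, -s)).1 := fun n x s ↦ by
    rw [hmir]
  have hmir2 : ∀ n (x : E) (s : ℝ), (T'^[n] (x, s)).2 = -(T^[n] (x, -s)).2 := fun n x s ↦ by
    rw [hmir]
  -- generic: `x`-components never grow
  have hfst : ∀ x ∈ Metric.ball (0 : E) ρ, ∀ t : ℝ, ∀ j, ‖(T^[j] (x, t)).1‖ ≤ ‖x‖ :=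
    fun x hxS t j ↦ iterate_fst_le hlam0 hlam1 hx (p := (x, t)) (mem_ball_zero_iff.1 hxS).le j
  -- lower sheets lie below upper sheets, hence so do the limits
  have hLH : ∀ x ∈ Metric.ball (0 : E) ρ, ∀ k k', -H' k' x < H k x := by
    intro x hxS k k'
    refine hbelow x hxS (-H' k' x) (fun n ↦ ?_) k
    have h := hnb' k' x hxS n
    rw [hmir1, hmir2] at h
    linarith
  have hlim : ∀ x ∈ Metric.ball (0 : E) ρ, -Hinf' x ≤ Hinf x := by
    intro x hxS
    have h1 : Tendsto (fun k ↦ H k x) atTop (𝓝 (Hinf x)) := hunif.tendsto_at hxS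
    have h2 : Tendsto (fun k ↦ -H' k x) atTop (𝓝 (-Hinf' x)) := (hunif'.tendsto_at hxS).neg
    exact le_of_tendsto_of_tendsto' h2 h1 fun k ↦ (hLH x hxS k k).le
  -- the two interpolation functionals
  obtain ⟨Ψp, hΨpc, hΨpmem, hΨp0, hΨpval⟩ := exists_interpolation (Metric.ball (0 : E) ρ) H Hinf
    hHc hdec hunif
  obtain ⟨Ψm, hΨmc, hΨmmem, hΨm0, hΨmval⟩ := exists_interpolation (Metric.ball (0 : E) ρ) H' Hinf'
    hHc' hdec' hunif'
  -- mutual exclusion of the two halves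
  have hexcl₁ : ∀ x ∈ Metric.ball (0 : E) ρ, ∀ t, 0 < Ψp (x, t) → Ψm (x, -t) = 0 := by
    intro x hxS t hpos
    have ht : Hinf x < t := by
      by_contra hle; push Not at hle
      exact hpos.ne' ((hΨp0 x hxS t).2 hle)
    exact (hΨm0 x hxS (-t)).2 (by linarith [hlim x hxS])
  have hexcl₂ : ∀ x ∈ Metric.ball (0 : E) ρ, ∀ t, 0 < Ψm (x, -t) → Ψp (x, t) = 0 := by
    intro x hxS t hpos
    have ht : Hinf' x < -t := by
      by_contra hle; push Not at hle
      exact hpos.ne' ((hΨm0 x hxS (-t)).2 hle)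
    exact (hΨp0 x hxS t).2 (by linarith [hlim x hxS])
  -- the functional and the code set
  set Φ : E × ℝ → ℝ := fun p ↦ Ψp (p.1, p.2) - Ψm (p.1, -p.2) with hΦ
  set K : Set ℝ := {0} ∪ range (fun m : ℕ ↦ (1 / 2 : ℝ) ^ (m + 1)) ∪
    range (fun m : ℕ ↦ -(1 / 2 : ℝ) ^ (m + 1)) with hK
  have h0S : (0 : E) ∈ Metric.ball (0 : E) ρ := Metric.mem_ball_self hρ
  -- `T 0 = 0`, so the zero orbit is never strictly above / below the noise level
  have hT0 : T 0 = 0 := by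
    have h1 : ‖(T 0).1‖ ≤ lam * ‖(0 : E × ℝ).1‖ := hx 0 (by simpa using hρ.le)
    have h2 : |(T ((0 : E), (0 : ℝ))).2| ≤ δ * ‖(0 : E)‖ := haxis 0 (by simpa using hρ.le)
    simp only [Prod.fst_zero, norm_zero, mul_zero, norm_le_zero_iff] at h1
    simp only [norm_zero, mul_zero, abs_nonpos_iff] at h2
    exact Prod.ext h1 h2
  have hiter0 : ∀ n, T^[n] ((0 : E), (0 : ℝ)) = 0 := fun n ↦ by
    rw [show ((0 : E), (0 : ℝ)) = (0 : E × ℝ) from rfl]; exact iterate_fixed hT0 n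
  refine ⟨Φ, K, ?_, ?_, ?_, ?_, ?_⟩
  · -- Φ 0 = 0
    have hp : Ψp ((0 : E), (0 : ℝ)) = 0 := by
      refine (hΨp0 0 h0S 0).2 ?_
      have hk : ∀ k, (0 : ℝ) < H k 0 := hbelow 0 h0S 0 (fun n ↦ by simp [hiter0 n])
      exact ge_of_tendsto' (hunif.tendsto_at h0S) fun k ↦ (hk k).le
    have hm : Ψm ((0 : E), (0 : ℝ)) = 0 := by
      refine (hΨm0 0 h0S 0).2 ?_
      have hk : ∀ k, (0 : ℝ) < H' k 0 := hbelow' 0 h0S 0 (fun n ↦ by simp [hmir, hiter0 n])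
      exact ge_of_tendsto' (hunif'.tendsto_at h0S) fun k ↦ (hk k).le
    show Ψp ((0 : E × ℝ).1, (0 : E × ℝ).2) - Ψm ((0 : E × ℝ).1, -(0 : E × ℝ).2) = 0
    simp only [Prod.fst_zero, Prod.snd_zero, neg_zero]
    rw [hp, hm, sub_self]
  · simp [hK]
  · -- two-sided accumulation of `K` at `0`
    intro η hη
    obtain ⟨m, hm⟩ := exists_pow_lt_of_lt_one hη (by norm_num : (1 / 2 : ℝ) < 1)
    have hm' : (1 / 2 : ℝ) ^ (m + 1) < η :=
      (pow_le_pow_of_le_one (by norm_num) (by norm_num) (Nat.le_succ m)).trans_lt hm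
    have hpos : 0 < (1 / 2 : ℝ) ^ (m + 1) := by positivity
    refine ⟨⟨-(1 / 2 : ℝ) ^ (m + 1), ?_, ?_⟩, ⟨(1 / 2 : ℝ) ^ (m + 1), ?_, ?_⟩⟩
    · simp [hK]
    · constructor <;> linarith
    · simp [hK]
    · constructor <;> linarith
  · -- continuity on the ball
    have hmaps₁ : MapsTo (fun p : E × ℝ ↦ (p.1, p.2)) (Metric.ball (0 : E × ℝ) ρ)
        (Metric.ball (0 : E) ρ ×ˢ univ) := by
      intro p hp
      refine ⟨mem_ball_zero_iff.2 (lt_of_le_of_lt (norm_fst_le p) (mem_ball_zero_iff.1 hp)), trivial⟩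
    have hmaps₂ : MapsTo (fun p : E × ℝ ↦ (p.1, -p.2)) (Metric.ball (0 : E × ℝ) ρ)
        (Metric.ball (0 : E) ρ ×ˢ univ) := by
      intro p hp
      refine ⟨mem_ball_zero_iff.2 (lt_of_le_of_lt (norm_fst_le p) (mem_ball_zero_iff.1 hp)), trivial⟩
    exact (hΨpc.comp (by fun_prop) hmaps₁).sub (hΨmc.comp (by fun_prop) hmaps₂)
  · -- the trichotomy
    rintro ⟨x, t⟩ hpS hcode
    have hxS : x ∈ Metric.ball (0 : E) ρ :=
      mem_ball_zero_iff.2 (lt_of_le_of_lt (norm_fst_le (x, t)) (mem_ball_zero_iff.1 hpS))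
    have hxρ := mem_ball_zero_iff.1 hxS
    have hu := hΨpmem x hxS t
    have hv := hΨmmem x hxS (-t)
    simp only [hΦ] at hcode
    have hcases : Ψp (x, t) - Ψm (x, -t) = 0 ∨ (∃ m : ℕ, Ψp (x, t) - Ψm (x, -t) = (1 / 2 : ℝ) ^ (m + 1))
        ∨ (∃ m : ℕ, Ψp (x, t) - Ψm (x, -t) = -(1 / 2 : ℝ) ^ (m + 1)) := by
      simp only [hK, mem_union, mem_singleton_iff, mem_range] at hcode
      rcases hcode with (h | ⟨m, hm⟩) | ⟨m, hm⟩
      · exact Or.inl h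
      · exact Or.inr (Or.inl ⟨m, hm.symm⟩)
      · exact Or.inr (Or.inr ⟨m, hm.symm⟩)
    rcases hcases with h0 | ⟨m, hm⟩ | ⟨m, hm⟩
    · -- code 0: between the limit sheets, the orbit stays in the ball
      left
      have hup : Ψp (x, t) = 0 := by
        by_contra hne
        have hpos : 0 < Ψp (x, t) := lt_of_le_of_ne hu.1 (Ne.symm hne)
        have := hexcl₁ x hxS t hpos
        exact hne (by linarith)
      have hvm : Ψm (x, -t) = 0 := by linarith
      have ht₁ : t ≤ Hinf x := (hΨp0 x hxS t).1 hup
      have ht₂ : -t ≤ Hinf' x := (hΨm0 x hxS (-t)).1 hvm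
      have hk₁ : ∀ k, t < H k x := fun k ↦
        ht₁.trans_lt (limit_lt_sheet _ H Hinf hdec hunif hxS k)
      have hk₂ : ∀ k, -t < H' k x := fun k ↦
        ht₂.trans_lt (limit_lt_sheet _ H' Hinf' hdec' hunif' hxS k)
      have hnoise₁ := habove x hxS t hk₁
      have hnoise₂ : ∀ n, -‖(T^[n] (x, t)).1‖ ≤ (T^[n] (x, t)).2 := fun n ↦ by
        have h := habove' x hxS (-t) hk₂ n
        rw [hmir1, hmir2] at h
        simp only [neg_neg] at h
        linarith
      intro n
      rw [mem_ball_zero_iff]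
      exact (iterate_norm_le_of_noise hlam0 hlam1 hx (p := (x, t)) hxρ.le hnoise₁ hnoise₂ n).trans_lt
        hxρ
    · -- positive code: on an upper sheet
      right; left
      have hpos : 0 < Ψp (x, t) := by
        have : 0 < (1 / 2 : ℝ) ^ (m + 1) := by positivity
        linarith [hv.1]
      have hvm := hexcl₁ x hxS t hpos
      have hval : Ψp (x, t) = (1 / 2 : ℝ) ^ (m + 1) := by linarith
      have ht : t = H (m + 1) x := (hΨpval x hxS t (m + 1) (Nat.succ_pos m)).1 hval
      refine ⟨N + (m + 1), ?_, fun j hj ↦ ⟨hfst x hxS t j, ?_, ?_⟩⟩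
      · rw [ht]; exact hhit (m + 1) x hxS
      · have h := hnb (m + 1) x hxS j
        rw [← ht] at h
        linarith [hfst x hxS t j]
      · have h := hb (m + 1) x hxS j hj
        rwa [← ht] at h
    · -- negative code: on a lower sheet
      right; right
      have hpos : 0 < Ψm (x, -t) := by
        have : 0 < (1 / 2 : ℝ) ^ (m + 1) := by positivity
        linarith [hu.1]
      have hum := hexcl₂ x hxS t hpos
      have hval : Ψm (x, -t) = (1 / 2 : ℝ) ^ (m + 1) := by linarith
      have ht : -t = H' (m + 1) x := (hΨmval x hxS (-t) (m + 1) (Nat.succ_pos m)).1 hval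
      refine ⟨N' + (m + 1), ?_, fun j hj ↦ ⟨hfst x hxS t j, ?_, ?_⟩⟩
      · have h := hhit' (m + 1) x hxS
        rw [← ht, hmir1, hmir2] at h
        simp only [neg_neg] at h
        linarith
      · have h := hb' (m + 1) x hxS j hj
        rw [← ht, hmir2] at h
        simp only [neg_neg] at h
        linarith
      · have h := hnb' (m + 1) x hxS j
        rw [← ht, hmir1, hmir2] at h
        simp only [neg_neg] at h
        linarith [hfst x hxS t j]

end Summit.FinalStateConjecture.FinalStateConjecture.Theorems.LaminatedThreshold.Comb
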